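import Mathlib
import Literature.Analysis.FluidPDE.SteadyNSLatticePersistence
import Literature.Analysis.FluidPDE.TorusABCFlow
import Summits.NavierStokesRegularity.FluidComputer.CubeShellAdjacency
import HarnessLib

/-!
# Nearest-neighbour Fourier coupling of the ABC linearisation: the support-sumset sentence of D2-CHAIN-MAP step S3 (cap g5, cell `ns-blowup`, 2026-08-26)

HONEST FRAMING (human ruling D-0035): nothing here is a claim about Navier–Stokes blow-up.
WHAT THIS IS NOT: not NS evidence. The one sentence of step S3 of `cap/D2-CHAIN-MAP.md` that was
still prose after `CubeShellAdjacency` (p433046): «the Fourier coefficient of `(U·∇)w` and of `(w·∇)U`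
at `k` involves only `ŵ(k − q)` with `q` in the Fourier support `{±eⱼ}` of `U`, hence a field supported
on the cube shell `|m|_∞ = J` is mapped into the window `J − 1 ≤ |k|_∞ ≤ J + 1`» — i.e. the head matrix
of the certificates is block-TRIDIAGONAL in the shell ordering (refuter2 K-note l.1727).

* lattice level (`Literature.Analysis.FluidPDE.ScalarFourier`'s `lconv`, `transportSym`):
  `lconv_eq_zero_of_forall`, `transportSym_eq_zero_of_forall` — a lattice convolution / transport symbol
  vanishes at `k` when every summand does; `transportSym_eq_zero_of_unit_host` /
  `transportSym_eq_zero_of_unit_coeff` — with one factor supported in `{|q|_∞ ≤ 1}` and the other on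
  the cube shell `J`, the symbol vanishes outside the window (via `CubeShellAdjacency.shell_window_of_unit`);
* the tree's ABC object: `mFourierCoeff_abcFlow_eq_zero` — `Û(m) = 0` unless `|mᵢ| ≤ 1` for all `i`;
  `mFourierCoeff_convect_abcFlow_eq_zero` / `mFourierCoeff_convect_abcFlow_eq_zero'` — for a smooth real
  field `w` on `𝕋³` whose Fourier coefficients vanish off the cube shell `J`, the coefficients of
  `(U·∇)w` and `(w·∇)U` (`U = Torus.abcFlow A B C`) vanish at every `k` outside
  `{J − 1 ≤ |k|_∞ ≤ J + 1}` (the tree's dictionary `SteadyLattice.mFourierCoeff_convect_real`).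

Mathlib + the tree's Fourier dictionary + `TorusABCFlow` + `CubeShellAdjacency`; no new definitions.
-/

noncomputable section

namespace Summit.NavierStokesRegularity.FluidComputer.ShellCouplingSupport

open Literature.Analysis.FluidPDE Literature.Analysis.FluidPDE.ScalarFourier
open Literature.Analysis.FluidPDE.SteadyLattice
open Literature.Analysis.FunctionSpaces Literature.Analysis.FunctionSpaces.Torus
open Literature.Analysis.FunctionSpaces.EuclideanSpace UnitAddTorus
open Summit.NavierStokesRegularity.FluidComputer.CubeShellAdjacency

/-! ## Lattice level -/

section Lattice

variable {d : Type*} [Fintype d]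

omit [Fintype d] in
/-- A lattice convolution vanishes at `k` if every summand does. -/
theorem lconv_eq_zero_of_forall {f g : (d → ℤ) → ℂ} {k : d → ℤ}
    (h : ∀ m, f m = 0 ∨ g (k - m) = 0) : lconv f g k = 0 := by
  rw [lconv_apply]
  have hz : (fun m => f m * g (k - m)) = fun _ => 0 := by
    funext m; rcases h m with h1 | h1 <;> simp [h1]
  rw [hz, tsum_zero]

/-- A transport symbol vanishes at `k` if every summand of every direction does. -/
theorem transportSym_eq_zero_of_forall {U : d → (d → ℤ) → ℂ} {c : (d → ℤ) → ℂ} {k : d → ℤ}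
    (h : ∀ j m, U j m = 0 ∨ c (k - m) = 0) : transportSym U c k = 0 := by
  rw [transportSym_apply]
  refine Finset.sum_eq_zero fun j _ => lconv_eq_zero_of_forall fun m => ?_
  rcases h j m with h1 | h1
  · exact Or.inl h1
  · exact Or.inr (by rw [h1, mul_zero])

/-- **Transport by a unit-shell host is nearest-neighbour in the cube shells.** If the host symbol
`U j` vanishes off `{|q|_∞ ≤ 1}` and the coefficient family `c` vanishes off the cube shell `J`
(`|mᵢ| ≤ J` for all `i`, `= J` for some `i`), then `transportSym U c k = 0` at every `k` outside the
window `{(∀ i, |kᵢ| ≤ J + 1) ∧ (∃ i, J − 1 ≤ |kᵢ|)}` — the symbol of `(U·∇)w`. -/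
theorem transportSym_eq_zero_of_unit_host {U : d → (d → ℤ) → ℂ} {c : (d → ℤ) → ℂ} {J : ℤ}
    (hU : ∀ j q, (¬ ∀ i, |q i| ≤ 1) → U j q = 0)
    (hc : ∀ m, (¬ ((∀ i, |m i| ≤ J) ∧ ∃ i, |m i| = J)) → c m = 0)
    {k : d → ℤ} (hk : ¬ ((∀ i, |k i| ≤ J + 1) ∧ ∃ i, J - 1 ≤ |k i|)) :
    transportSym U c k = 0 := by
  refine transportSym_eq_zero_of_forall fun j q => ?_
  by_cases hq : ∀ i, |q i| ≤ 1
  · by_cases hm : (∀ i, |(k - q) i| ≤ J) ∧ ∃ i, |(k - q) i| = J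
    · exfalso; apply hk
      have hw := shell_window_of_unit (p := k - q) (q := q) hq hm.1 hm.2
      rwa [sub_add_cancel] at hw
    · exact Or.inr (hc _ hm)
  · exact Or.inl (hU j q hq)

/-- **Stretching of a unit-shell host is nearest-neighbour in the cube shells.** If the transporting
family `W j` vanishes off the cube shell `J` and the transported coefficients `u` vanish off
`{|q|_∞ ≤ 1}`, then `transportSym W u k = 0` outside the same window — the symbol of `(w·∇)U`. -/
theorem transportSym_eq_zero_of_unit_coeff {W : d → (d → ℤ) → ℂ} {u : (d → ℤ) → ℂ} {J : ℤ}
    (hW : ∀ j m, (¬ ((∀ i, |m i| ≤ J) ∧ ∃ i, |m i| = J)) → W j m = 0)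
    (hu : ∀ q, (¬ ∀ i, |q i| ≤ 1) → u q = 0)
    {k : d → ℤ} (hk : ¬ ((∀ i, |k i| ≤ J + 1) ∧ ∃ i, J - 1 ≤ |k i|)) :
    transportSym W u k = 0 := by
  refine transportSym_eq_zero_of_forall fun j m => ?_
  by_cases hm : (∀ i, |m i| ≤ J) ∧ ∃ i, |m i| = J
  · by_cases hq : ∀ i, |(k - m) i| ≤ 1
    · exfalso; apply hk
      have hw := shell_window_of_unit (p := m) (q := k - m) hq hm.1 hm.2
      rwa [add_sub_cancel] at hw
    · exact Or.inr (hu _ hq)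
  · exact Or.inl (hW j m hm)

end Lattice

/-! ## The ABC host on the unit torus -/

/-- The ABC flow is Fourier-supported on the unit shell: `Û(m) = 0` unless `|mᵢ| ≤ 1` for all `i`
(indeed unless `m ∈ {±eⱼ}`, `Torus.mFourierCoeff_abcFlow`). -/
theorem mFourierCoeff_abcFlow_eq_zero (A B C : ℝ) {m : Fin 3 → ℤ} (hm : ¬ ∀ i, |m i| ≤ 1) :
    mFourierCoeff (complexify ∘ Torus.abcFlow A B C) m = 0 := by
  rw [Torus.mFourierCoeff_abcFlow, if_neg]
  intro hmem
  obtain ⟨⟨j, b⟩, rfl⟩ := Torus.mem_abcFreq.mp hmem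
  apply hm
  intro i
  rw [Torus.abcDir_apply]
  split_ifs <;> simp

/-- **S3 for the transport term.** For `U = Torus.abcFlow A B C` and a smooth real field `w` on `𝕋³`
whose Fourier coefficients vanish off the cube shell `J`, the Fourier coefficients of `(U·∇)w` vanish
at every `k` outside the window `{(∀ i, |kᵢ| ≤ J + 1) ∧ (∃ i, J − 1 ≤ |kᵢ|)}`. -/
theorem mFourierCoeff_convect_abcFlow_eq_zero (A B C : ℝ) {w : UnitAddTorus (Fin 3) → EuclideanSpace ℝ (Fin 3)}
    (hw : IsSmooth w) {J : ℤ}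
    (hsupp : ∀ m, (¬ ((∀ i, |m i| ≤ J) ∧ ∃ i, |m i| = J)) → mFourierCoeff (complexify ∘ w) m = 0)
    {k : Fin 3 → ℤ} (hk : ¬ ((∀ i, |k i| ≤ J + 1) ∧ ∃ i, J - 1 ≤ |k i|)) :
    mFourierCoeff (complexify ∘ Torus.convect (Torus.abcFlow A B C) w) k = 0 := by
  rw [mFourierCoeff_convect_real (Torus.isSmooth_abcFlow A B C) hw k]
  ext p
  rw [PiLp.toLp_apply]
  refine (transportSym_eq_zero_of_unit_host (J := J) ?_ ?_ hk).trans (by simp)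
  · intro j q hq; rw [mFourierCoeff_abcFlow_eq_zero A B C hq]; rfl
  · intro m hm; rw [hsupp m hm]; rfl

/-- **S3 for the stretching term.** Same hypotheses: the Fourier coefficients of `(w·∇)U` vanish at
every `k` outside the window. -/
theorem mFourierCoeff_convect_abcFlow_eq_zero' (A B C : ℝ) {w : UnitAddTorus (Fin 3) → EuclideanSpace ℝ (Fin 3)}
    (hw : IsSmooth w) {J : ℤ}
    (hsupp : ∀ m, (¬ ((∀ i, |m i| ≤ J) ∧ ∃ i, |m i| = J)) → mFourierCoeff (complexify ∘ w) m = 0)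
    {k : Fin 3 → ℤ} (hk : ¬ ((∀ i, |k i| ≤ J + 1) ∧ ∃ i, J - 1 ≤ |k i|)) :
    mFourierCoeff (complexify ∘ Torus.convect w (Torus.abcFlow A B C)) k = 0 := by
  rw [mFourierCoeff_convect_real hw (Torus.isSmooth_abcFlow A B C) k]
  ext p
  rw [PiLp.toLp_apply]
  refine (transportSym_eq_zero_of_unit_coeff (J := J) ?_ ?_ hk).trans (by simp)
  · intro j m hm; rw [hsupp m hm]; rfl
  · intro q hq; rw [mFourierCoeff_abcFlow_eq_zero A B C hq]; rfl

end Summit.NavierStokesRegularity.FluidComputer.ShellCouplingSupport
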